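import Literature.NumberTheory.EllipticCurves.CongruentNumberCurveHeckeSeries
import Literature.NumberTheory.EllipticCurves.BSDAnalyticRankTunnellWaldspurgerProofs
import HarnessLib

/-!
# Tunnell's converse for `E_n`: the remaining inputs, the vanishing form from Waldspurger's
proportionality alone, global minimality of `y² = x³ - n² x`, and the printed expansion of `φ`

Sibling proof file of `Literature.NumberTheory.EllipticCurves.BSDAnalyticRank` for the named
facts `Literature.NumberTheory.EllipticCurves.tunnell_converse_odd` / `Literature.NumberTheory.EllipticCurves.tunnell_converse_even` (**bsd.S29**, the converse of
Tunnell's theorem under BSD(RANK) for the congruent number curves `E_n : y² = x³ - n² x`).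
The tree now reduces them, with complete proofs, to printed statements in two steps:
`BSDAnalyticRankTunnellProofs` (to Tunnell's Theorem 3, `Tunnell1983_L_one_odd/even`, and the
continuation of `L(E_n, s)`), then `BSDAnalyticRankTunnellWaldspurgerProofs` (Theorem 3
from Waldspurger's proportionality `Tunnell1983_a/b_sq_eq_const_mul_L_one` and the four `L`-values
`BirchSwinnertonDyer1965_L_one_one_three` / `_two_ten`) and `CongruentNumberCurveHeckeSeries`
(the continuation from Ireland–Rosen's Theorem 18.5(ii),
`IrelandRosen1990_card_points_one_mod_four`, via `L(E_n, s) = L(s, χ_n)` and Hecke's theta series,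
`GaussianPrimary`, `GaussianThetaSeries`).
This file records the end of that chain and two checks on its objects:

* `Literature.NumberTheory.EllipticCurves.tunnell_lvalue_odd_of_waldspurger`, `Literature.NumberTheory.EllipticCurves.tunnell_lvalue_even_of_waldspurger` —
  **Tunnell's theorem in vanishing form (`tunnell_lvalue_odd/even` of `BSDAnalyticRankProofs`:
  `L(E_n, 1) = 0 ↔` the count identity) from Waldspurger's proportionality for `g θ₂` (resp.
  `g θ₄`) and the continuation of `L(E_n, s)` for squarefree `n` alone**
  (`Tunnell1983_a/b_sq_eq_const_mul_L_one`: Tunnell 1983, p. 329; forms of weight `3/2`, the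
  Shimura lift and Waldspurger 1981 — a theory absent from Mathlib): the four `L`-values of
  Birch–Swinnerton-Dyer (1965) that Theorem 3 needs in addition only fix the VALUE `4/β` of the
  constants `β₁², β₃²`, while `a(1) = 1`, `a(3) = 2` (resp. `b(1) = 1`, `b(5) = 2`) already force
  them to be nonzero. (The continuation is meanwhile a theorem of the tree,
  `hasEntireLFunction_congruentNumberCurve_holds` of the sibling
  `CongruentNumberCurveLSeriesProofs`, which has the one-sided
  `entireLFunction_one_eq_zero_of_a/b_eq_zero` and
  `tunnell_converse_odd/even_of_waldspurger`: bsd.S29's converse behind ONE named fact.)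
* `Literature.NumberTheory.EllipticCurves.tunnell_converse_odd_of_card_points_of_waldspurger`,
  `Literature.NumberTheory.EllipticCurves.tunnell_converse_even_of_card_points_of_waldspurger` — **`tunnell_converse_odd` (resp.
  `_even`) from the three named facts of the printed proof** (the first since discharged by
  `IrelandRosen1990_card_points_one_mod_four_holds` of `CongruentNumberCurveJacobiSums`):
  Ireland–Rosen's
  Theorem 18.5(ii) (Jacobi sums of the quartic character), Waldspurger's proportionality for
  `g θ₂` (resp. `g θ₄`) (Tunnell 1983, p. 329; forms of weight `3/2`, the Shimura lift and
  Waldspurger 1981 — a theory absent from Mathlib), and the two CM `L`-values `L(E¹, 1) = β/4`,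
  `L(E³, 1) = β/√3` (resp. `L(E², 1)`, `L(E¹⁰, 1)`; Birch–Swinnerton-Dyer 1965, Table 1); with
  `Tunnell1983_L_one_odd/even_of_card_points_of_waldspurger`, Theorem 3 itself from the same.
* **`y² = x³ - n² x` is a global minimal Weierstrass equation for every squarefree `n`**
  (`Literature.NumberTheory.EllipticCurves.isGloballyMinimal_congruentNumberCurve`): integral, minimal at the odd places because
  `ord_p Δ = ord_p (64 n⁶) = 6 ord_p n ≤ 6 < 12` (Silverman, *AEC* VII.1 Remark 1.1; the order
  bound `Literature.NumberTheory.EllipticCurves.exp_neg_two_lt_valuation_natCast` for squarefree integers), and at `2` by the same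
  remark for odd `n` (`ord₂ Δ = 6`) and by the sibling's
  `isMinimalAt_congruentNumberCurve_two_of_even` for even `n` (`ord₂ Δ = 12`, Silverman VII.1
  directly). Hence the tree's invariants of global minimal models — `integralModelInt`,
  `reductionPointCount`, `frobeniusTrace` (the `N_p`, `a_p` of **bsd.S35**,
  `analyticRank_eq_of_isEquivalent_prod`) — are those of the naive model
  `congruentNumberCurveInt n = ⟨0, 0, 0, -n², 0⟩` (`reductionPointCount_congruentNumberCurve`,
  `frobeniusTrace_congruentNumberCurve`); also `E_n` has good reduction at every `p ∤ 2n` in the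
  prime-indexed sense (`hasGoodReductionAtPrime_congruentNumberCurve`) and the `p`-th
  coefficient of `L(E_n, s)` is `p + 1 - #Ẽ_n(𝔽_p)` there for every `n`
  (`LFunction_congruentNumberCurve_prime`; for squarefree `n` this is part of the sibling's
  `lFunction_congruentNumberCurve_apply_prime`).
* **Tunnell's printed expansion `φ = q - 2q⁵ - 3q⁹ + 6q¹³ + 2q¹⁷ + ⋯`** (Invent. Math. 72,
  p. 325:
  "The expansion begins `φ = q - 2q⁵ - 3q⁹ + 6q¹³ + 2q¹⁷ + …`", the newform of level `32` with
  `L(E¹, s) = L(φ, s) = ∑ χ(𝔞) N𝔞^{-s}`) checked against the tree's Hecke coefficients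
  `S(m) = ∑_{x primary, N x = m} x` of `GaussianPrimary` (`a_m(E_1) = S(m)` by
  `lFunction_congruentNumberCurve_eq_jacobiSym_mul_primarySum`): `S(5) = -2`, `S(9) = -3`,
  `S(13) = 6`, `S(17) = 2` (`Literature.GaussianPrimary.primarySum_five/nine/thirteen/seventeen`), and
  `S(m) = 0` unless `m ≡ 1 (mod 4)` (`primarySum_eq_zero_of_mod_four_ne_one`, from
  `IsPrimary.norm_mod_four`: a primary `a + bi` has `a` odd and `b` even).

## References

* J. B. Tunnell, *A classical Diophantine problem and modular forms of weight 3/2*, Invent. Math.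
  72 (1983) 323–334: §1 p. 325 (the expansion of `φ`), Thm 3 and its proof pp. 328–329, §3 p. 330.
* K. Ireland, M. Rosen, *A Classical Introduction to Modern Number Theory*, GTM 84 (1st ed. 1982,
  2nd ed. 1990; held scan `book:ireland1982-classical-introduction-modern-number-theory`), Ch. 9 §7
  Lemma 6 (primary elements), Ch. 18 §4 Thm 5, §6 Thm 7.
* J. H. Silverman, *The Arithmetic of Elliptic Curves*, GTM 106, 2nd ed. (2009), VII.1 Remark 1.1,
  VII.5 Prop. 5.1(a), VIII.8 (global minimal models), Exercise 8.19(a).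
-/

noncomputable section

open scoped Classical NumberField

open WeierstrassCurve

namespace Literature.NumberTheory.EllipticCurves

/-! ### The three remaining named facts imply `tunnell_converse_odd/even` -/

/-- **Tunnell's Theorem 3, odd twists, from the three named facts still open in the tree**:
Waldspurger's proportionality for `g θ₂` (`Tunnell1983_a_sq_eq_const_mul_L_one`), the values
`L(E¹, 1) = β/4`, `L(E³, 1) = β/√3` (`BirchSwinnertonDyer1965_L_one_one_three`) and
Ireland–Rosen's Theorem 18.5(ii) (`IrelandRosen1990_card_points_one_mod_four`, which supplies the
continuation of `L(E_n, s)` through `hasEntireLFunction_congruentNumberCurve_of_card_points`);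
composition of the siblings' `Tunnell1983_L_one_odd_of_facts`.
[cite: Tunnell1983Congruent, Thm 3 and its proof, pp. 328–329] -/
theorem Tunnell1983_L_one_odd_of_card_points_of_waldspurger
    (h185 : IrelandRosen1990_card_points_one_mod_four) (hW : Tunnell1983_a_sq_eq_const_mul_L_one)
    (hV : BirchSwinnertonDyer1965_L_one_one_three) : Tunnell1983_L_one_odd :=
  Tunnell1983_L_one_odd_of_facts hW hV
    (hasEntireLFunction_congruentNumberCurve_of_card_points h185)

/-- **Tunnell's Theorem 3, even twists, from the three named facts still open in the tree**
(`Tunnell1983_b_sq_eq_const_mul_L_one`, `BirchSwinnertonDyer1965_L_one_two_ten`,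
`IrelandRosen1990_card_points_one_mod_four`).
[cite: Tunnell1983Congruent, Thm 3 and its proof, pp. 328–329] -/
theorem Tunnell1983_L_one_even_of_card_points_of_waldspurger
    (h185 : IrelandRosen1990_card_points_one_mod_four) (hW : Tunnell1983_b_sq_eq_const_mul_L_one)
    (hV : BirchSwinnertonDyer1965_L_one_two_ten) : Tunnell1983_L_one_even :=
  Tunnell1983_L_one_even_of_facts hW hV
    (hasEntireLFunction_congruentNumberCurve_of_card_points h185)

/-- **`Literature.NumberTheory.EllipticCurves.tunnell_converse_odd` (bsd.S29, odd case) from the three named facts still open in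
the tree**: Ireland–Rosen's Theorem 18.5(ii) (`IrelandRosen1990_card_points_one_mod_four`:
Jacobi sums), Waldspurger's proportionality for `g θ₂` (`Tunnell1983_a_sq_eq_const_mul_L_one`:
weight `3/2`, Shimura lift, Waldspurger 1981) and the two `L`-values
`BirchSwinnertonDyer1965_L_one_one_three`. Everything else of the printed proof (Tunnell 1983
§3 p. 330 with Thm 3 p. 329; Ireland–Rosen Ch. 18; Koblitz Ch. II §5) is proved in the tree:
the sibling's `tunnell_converse_odd_of_L_one_of_card_points` composed with
`Tunnell1983_L_one_odd_of_card_points_of_waldspurger`.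
[cite: Tunnell1983Congruent, §3 (p. 330) and Thm 3 (pp. 328–329)] -/
theorem tunnell_converse_odd_of_card_points_of_waldspurger
    (h185 : IrelandRosen1990_card_points_one_mod_four) (hW : Tunnell1983_a_sq_eq_const_mul_L_one)
    (hV : BirchSwinnertonDyer1965_L_one_one_three) : tunnell_converse_odd :=
  tunnell_converse_odd_of_L_one_of_card_points
    (Tunnell1983_L_one_odd_of_card_points_of_waldspurger h185 hW hV) h185

/-- **`Literature.NumberTheory.EllipticCurves.tunnell_converse_even` (bsd.S29, even case) from the three named facts still open in
the tree** (`IrelandRosen1990_card_points_one_mod_four`, `Tunnell1983_b_sq_eq_const_mul_L_one`,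
`BirchSwinnertonDyer1965_L_one_two_ten`).
[cite: Tunnell1983Congruent, §3 (p. 330) and Thm 3 (pp. 328–329)] -/
theorem tunnell_converse_even_of_card_points_of_waldspurger
    (h185 : IrelandRosen1990_card_points_one_mod_four) (hW : Tunnell1983_b_sq_eq_const_mul_L_one)
    (hV : BirchSwinnertonDyer1965_L_one_two_ten) : tunnell_converse_even :=
  tunnell_converse_even_of_L_one_of_card_points
    (Tunnell1983_L_one_even_of_card_points_of_waldspurger h185 hW hV) h185

/-! ### Tunnell's printed expansion of `φ` against the Hecke coefficients `S(m)` -/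

namespace GaussianPrimary

local notation "ℤ[i]" => GaussianInt

/-- A primary `a + bi` has norm `a² + b² ≡ 1 (mod 4)` (`a` odd, `b` even; Ireland–Rosen Ch. 9 §7,
Lemma 6). [folklore] -/
theorem _root_.Literature.NumberTheory.QuadraticFields.GaussianPrimary.IsPrimary.norm_mod_four {x : ℤ[i]} (h : QuadraticFields.GaussianPrimary.IsPrimary x) : x.norm % 4 = 1 := by
  rw [Zsqrtd.norm_def]
  unfold QuadraticFields.GaussianPrimary.IsPrimary at h
  have h4 : x.re * x.re - -1 * x.im * x.im = x.re * x.re + x.im * x.im := by ring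
  rw [h4]
  rcases h with ⟨ha, hb⟩ | ⟨ha, hb⟩
  · rw [Int.add_emod, Int.mul_emod, ha, Int.mul_emod x.im, hb]; decide
  · rw [Int.add_emod, Int.mul_emod, ha, Int.mul_emod x.im, hb]; decide

/-- There is no primary Gaussian integer of norm `m ≢ 1 (mod 4)`. [folklore] -/
theorem primaryNormEq_eq_empty_of_mod_four_ne_one {m : ℕ} (hm : m % 4 ≠ 1) :
    QuadraticFields.GaussianPrimary.primaryNormEq m = ∅ := by
  refine Finset.eq_empty_of_forall_notMem fun x hx ↦ hm ?_
  rw [QuadraticFields.GaussianPrimary.mem_primaryNormEq] at hx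
  have h := hx.2.norm_mod_four
  rw [hx.1] at h
  omega

/-- **`S(m) = 0` unless `m ≡ 1 (mod 4)`**: the level-`32` newform `φ = ∑ S(m) q^m` is supported on
exponents `≡ 1 (mod 4)` (`φ = q - 2q⁵ - 3q⁹ + 6q¹³ + ⋯`, Tunnell 1983, p. 325); in particular
`S(p) = 0` at the inert primes `p ≡ 3 (4)` (`a_p = 0`, Ireland–Rosen Ch. 18 §6). [folklore] -/
theorem primarySum_eq_zero_of_mod_four_ne_one {m : ℕ} (hm : m % 4 ≠ 1) : QuadraticFields.GaussianPrimary.primarySum m = 0 := by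
  rw [QuadraticFields.GaussianPrimary.primarySum, primaryNormEq_eq_empty_of_mod_four_ne_one hm, Finset.sum_empty]

/-- If `a² + b² = m < (k + 1)²` with `k ≥ 0` then `|a|, |b| ≤ k`. [folklore] -/
theorem abs_le_of_sq_add_sq_eq {a b m k : ℤ} (h : a ^ 2 + b ^ 2 = m) (hk : 0 ≤ k)
    (hm : m < (k + 1) ^ 2) : (-k ≤ a ∧ a ≤ k) ∧ (-k ≤ b ∧ b ≤ k) := by
  have ha := abs_lt_of_sq_lt_sq' (show a ^ 2 < (k + 1) ^ 2 by nlinarith [sq_nonneg b])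
    (by linarith)
  have hb := abs_lt_of_sq_lt_sq' (show b ^ 2 < (k + 1) ^ 2 by nlinarith [sq_nonneg a])
    (by linarith)
  omega

/-- Membership in `primaryNormEq m` for `x = a + bi`, on coordinates. [folklore] -/
theorem mk_mem_primaryNormEq {m : ℕ} {a b : ℤ} :
    (⟨a, b⟩ : ℤ[i]) ∈ QuadraticFields.GaussianPrimary.primaryNormEq m ↔
      a ^ 2 + b ^ 2 = m ∧ (a % 4 = 1 ∧ b % 4 = 0 ∨ a % 4 = 3 ∧ b % 4 = 2) := by
  rw [QuadraticFields.GaussianPrimary.mem_primaryNormEq, Zsqrtd.norm_def, QuadraticFields.GaussianPrimary.IsPrimary]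
  simp only
  constructor
  · rintro ⟨h, hp⟩; exact ⟨by linear_combination h, hp⟩
  · rintro ⟨h, hp⟩; exact ⟨by linear_combination h, hp⟩

/-- `primaryNormEq 5 = {-1 + 2i, -1 - 2i}` (`5 = N(-1 ± 2i)`, `-1 + 2i ≡ 1 (2 + 2i)`). [folklore] -/
theorem primaryNormEq_five : QuadraticFields.GaussianPrimary.primaryNormEq 5 = {⟨-1, 2⟩, ⟨-1, -2⟩} := by
  ext ⟨a, b⟩
  simp only [mk_mem_primaryNormEq, Finset.mem_insert, Finset.mem_singleton, Zsqrtd.mk.injEq,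
    Nat.cast_ofNat]
  constructor
  · rintro ⟨h, hp⟩
    obtain ⟨⟨ha₁, ha₂⟩, ⟨hb₁, hb₂⟩⟩ := abs_le_of_sq_add_sq_eq h (show (0 : ℤ) ≤ 2 by norm_num)
      (by norm_num)
    interval_cases a <;> interval_cases b <;> revert h hp <;> norm_num
  · rintro (⟨rfl, rfl⟩ | ⟨rfl, rfl⟩) <;> exact ⟨by norm_num, Or.inr ⟨by decide, by decide⟩⟩

/-- **`S(5) = -2`**: Tunnell's `φ = q - 2q⁵ + ⋯` (`a₅(E) = -2`, `#E(𝔽₅) = 8`).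
[cite: Tunnell1983Congruent, §1 (p. 325)] -/
theorem primarySum_five : QuadraticFields.GaussianPrimary.primarySum 5 = -2 := by
  rw [QuadraticFields.GaussianPrimary.primarySum, primaryNormEq_five, Finset.sum_pair (by decide)]
  ext <;> rfl

/-- `primaryNormEq 9 = {-3}` (`3` is inert; `-3 ≡ 1 (2 + 2i)`, Ireland–Rosen Ch. 18 §6:
`χ((p)) = -p`). [folklore] -/
theorem primaryNormEq_nine : QuadraticFields.GaussianPrimary.primaryNormEq 9 = {⟨-3, 0⟩} := by
  ext ⟨a, b⟩
  simp only [mk_mem_primaryNormEq, Finset.mem_singleton, Zsqrtd.mk.injEq, Nat.cast_ofNat]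
  constructor
  · rintro ⟨h, hp⟩
    obtain ⟨⟨ha₁, ha₂⟩, ⟨hb₁, hb₂⟩⟩ := abs_le_of_sq_add_sq_eq h (show (0 : ℤ) ≤ 3 by norm_num)
      (by norm_num)
    interval_cases a <;> interval_cases b <;> revert h hp <;> norm_num
  · rintro ⟨rfl, rfl⟩; exact ⟨by norm_num, Or.inl ⟨by decide, by decide⟩⟩

/-- **`S(9) = -3`**: Tunnell's `φ = q - 2q⁵ - 3q⁹ + ⋯`. [cite: Tunnell1983Congruent, §1 (p. 325)] -/
theorem primarySum_nine : QuadraticFields.GaussianPrimary.primarySum 9 = -3 := by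
  rw [QuadraticFields.GaussianPrimary.primarySum, primaryNormEq_nine, Finset.sum_singleton]
  ext <;> rfl

/-- `primaryNormEq 13 = {3 + 2i, 3 - 2i}` (Ireland–Rosen's example after Thm 18.5:
`13 = (3 + 2i)(3 - 2i)`, `3 + 2i ≡ 1 (2 + 2i)`, `N₁₃ = 14 - 6 = 8`). [folklore] -/
theorem primaryNormEq_thirteen : QuadraticFields.GaussianPrimary.primaryNormEq 13 = {⟨3, 2⟩, ⟨3, -2⟩} := by
  ext ⟨a, b⟩
  simp only [mk_mem_primaryNormEq, Finset.mem_insert, Finset.mem_singleton, Zsqrtd.mk.injEq,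
    Nat.cast_ofNat]
  constructor
  · rintro ⟨h, hp⟩
    obtain ⟨⟨ha₁, ha₂⟩, ⟨hb₁, hb₂⟩⟩ := abs_le_of_sq_add_sq_eq h (show (0 : ℤ) ≤ 3 by norm_num)
      (by norm_num)
    interval_cases a <;> interval_cases b <;> revert h hp <;> norm_num
  · rintro (⟨rfl, rfl⟩ | ⟨rfl, rfl⟩) <;> exact ⟨by norm_num, Or.inr ⟨by decide, by decide⟩⟩

/-- **`S(13) = 6`**: Tunnell's `φ = ⋯ + 6q¹³ + ⋯` (`a₁₃(E) = 6`).
[cite: Tunnell1983Congruent, §1 (p. 325)] -/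
theorem primarySum_thirteen : QuadraticFields.GaussianPrimary.primarySum 13 = 6 := by
  rw [QuadraticFields.GaussianPrimary.primarySum, primaryNormEq_thirteen, Finset.sum_pair (by decide)]
  ext <;> rfl

/-- `primaryNormEq 17 = {1 + 4i, 1 - 4i}` (`17 = (1 + 4i)(1 - 4i)`, `1 + 4i ≡ 1 (2 + 2i)`).
[folklore] -/
theorem primaryNormEq_seventeen : QuadraticFields.GaussianPrimary.primaryNormEq 17 = {⟨1, 4⟩, ⟨1, -4⟩} := by
  ext ⟨a, b⟩
  simp only [mk_mem_primaryNormEq, Finset.mem_insert, Finset.mem_singleton, Zsqrtd.mk.injEq,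
    Nat.cast_ofNat]
  constructor
  · rintro ⟨h, hp⟩
    obtain ⟨⟨ha₁, ha₂⟩, ⟨hb₁, hb₂⟩⟩ := abs_le_of_sq_add_sq_eq h (show (0 : ℤ) ≤ 4 by norm_num)
      (by norm_num)
    interval_cases a <;> interval_cases b <;> revert h hp <;> norm_num
  · rintro (⟨rfl, rfl⟩ | ⟨rfl, rfl⟩) <;> exact ⟨by norm_num, Or.inl ⟨by decide, by decide⟩⟩

/-- **`S(17) = 2`**: Tunnell's `φ = ⋯ + 2q¹⁷ + ⋯`. [cite: Tunnell1983Congruent, §1 (p. 325)] -/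
theorem primarySum_seventeen : QuadraticFields.GaussianPrimary.primarySum 17 = 2 := by
  rw [QuadraticFields.GaussianPrimary.primarySum, primaryNormEq_seventeen, Finset.sum_pair (by decide)]
  ext <;> rfl

end GaussianPrimary

/-! ### `y² = x³ - n² x` is a global minimal equation for every squarefree `n` -/

section GlobalMinimal

open IsDedekindDomain Rat.HeightOneSpectrum

variable (v : HeightOneSpectrum (𝓞 ℚ))

/-- **A squarefree natural number has `ord_v ≤ 1` at every finite place**: `exp (-2) < v (m)`
in `ℤᵐ⁰`, i.e. `v² ∤ (m)`; for if `(m) ⊆ v² = (p²)` (`p` the prime under `v`,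
`Literature.NumberTheory.GaloisRepresentations.Rat.asIdeal_eq_span_natGenerator`) then `p² ∣ m`. (The tree has the valuation of `p`
itself, `Literature.NumberTheory.GaloisRepresentations.Rat.valuation_natGenerator`, and of the integers prime to `p` or divisible by `pᵉ`,
`Literature.NumberTheory.GaloisRepresentations.Rat.valuation_intCast_eq_one` / `_le`, but not this upper bound on the order.) [folklore] -/
theorem exp_neg_two_lt_valuation_natCast {m : ℕ} (hm : Squarefree m) :
    WithZero.exp (-2 : ℤ) < v.valuation ℚ (m : ℚ) := by
  rw [GaloisRepresentations.Rat.valuation_natCast, ← not_le]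
  intro hle
  have h₂ : (m : 𝓞 ℚ) ∈ v.asIdeal ^ 2 := by
    rw [← HeightOneSpectrum.intValuation_le_pow_iff_mem]
    exact_mod_cast hle
  rw [GaloisRepresentations.Rat.asIdeal_eq_span_natGenerator, Ideal.span_singleton_pow, Ideal.mem_span_singleton] at h₂
  have h₃ := map_dvd (Rat.IsIntegralClosure.intEquiv (𝓞 ℚ)) h₂
  rw [map_pow, map_natCast, map_natCast] at h₃
  have h₄ : natGenerator v * natGenerator v ∣ m := by rw [← sq]; exact_mod_cast h₃
  exact (prime_natGenerator v).one_lt.ne' (Nat.isUnit_iff.1 (hm _ h₄))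

/-- `Δ(E_n) = 64 n⁶ = 2⁶ n⁶` in `ℚ`. [folklore] -/
theorem congruentNumberCurve_Δ_eq_pow (n : ℕ) :
    (congruentNumberCurve n).Δ = ((2 : ℕ) : ℚ) ^ 6 * ((n : ℕ) : ℚ) ^ 6 := by
  rw [congruentNumberCurve_Δ]
  push_cast
  ring

/-- **At an odd place, `ord_v Δ(E_n) < 12` for squarefree `n`**: `Δ = 2⁶ n⁶` with `|2|_v = 1` and
`exp (-2) < |n|_v` (`exp_neg_two_lt_valuation_natCast`), so `exp (-12) < |Δ|_v`. [folklore] -/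
theorem exp_neg_twelve_lt_valuation_congruentNumberCurve_Δ {n : ℕ} (hn : Squarefree n)
    (hv : natGenerator v ≠ 2) :
    WithZero.exp (-12 : ℤ) < v.valuation ℚ (congruentNumberCurve n).Δ := by
  have h2 : v.valuation ℚ ((2 : ℕ) : ℚ) = 1 := by
    rw [show ((2 : ℕ) : ℚ) = ((2 : ℤ) : ℚ) by norm_num]
    refine GaloisRepresentations.Rat.valuation_intCast_eq_one v fun h ↦ hv ?_
    exact (Nat.prime_dvd_prime_iff_eq (prime_natGenerator v) Nat.prime_two).1 (by exact_mod_cast h)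
  have h := exp_neg_two_lt_valuation_natCast v hn
  have h0 : v.valuation ℚ ((n : ℕ) : ℚ) ≠ 0 :=
    (Valuation.ne_zero_iff _).2 (by exact_mod_cast hn.ne_zero)
  rw [congruentNumberCurve_Δ_eq_pow, map_mul, map_pow, map_pow, h2, one_pow, one_mul,
    ← WithZero.exp_log h0, ← WithZero.exp_nsmul, WithZero.exp_lt_exp]
  rw [← WithZero.exp_log h0, WithZero.exp_lt_exp] at h
  rw [nsmul_eq_mul]
  omega

/-- **At the place over `2`, `ord₂ Δ(E_n) = 6 < 12` for odd `n`** (`Δ = 2⁶ n⁶`, `|n|₂ = 1`;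
the sibling's `valuation_congruentNumberCurve_Δ_of_two` gives the exact value `exp (-6)`).
[folklore] -/
theorem exp_neg_twelve_lt_valuation_congruentNumberCurve_Δ_two {n : ℕ} (hodd : Odd n)
    (hv : natGenerator v = 2) :
    WithZero.exp (-12 : ℤ) < v.valuation ℚ (congruentNumberCurve n).Δ := by
  rw [valuation_congruentNumberCurve_Δ_of_two v hodd hv, WithZero.exp_lt_exp]
  norm_num

/-- **`E_n : y² = x³ - n² x` is a global minimal Weierstrass equation for every squarefree `n`**
(Silverman, *AEC* VIII.8): it is integral (`valuation_congruentNumberCurve_a_le_one`), minimal at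
every odd place and, for odd `n`, at `2` because `ord_v Δ < 12` there (VII.1 Remark 1.1, the
tree's `isMinimalAt_of_lt_valuation_Δ_holds`), and minimal at `2` for even squarefree `n` by
the sibling's `isMinimalAt_congruentNumberCurve_two_of_even` (`ord₂ Δ = 12`; Silverman VII.1
directly). So the tree's invariants of global minimal models (`integralModelInt`,
`minimalDiscriminantInt`, `reductionPointCount`, `frobeniusTrace`) may be computed on
`y² = x³ - n² x` itself. (Koblitz Ch. II §5 / Ireland–Rosen Ch. 18 §4: `Δ = 2⁶ D³`; the conductor
of `E_n` is `32 n²` for odd `n` and `16 n²` for even `n`.) [folklore] -/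
theorem isGloballyMinimal_congruentNumberCurve {n : ℕ} (hn : Squarefree n) :
    (congruentNumberCurve n).IsGloballyMinimal where
  isIntegral := isIntegral_of_exists_lift _ ⟨0, by simp⟩ ⟨0, by simp⟩ ⟨0, by simp⟩
    ⟨-((n : 𝓞 ℚ) ^ 2), by simp⟩ ⟨0, by simp⟩
  isMinimal v := by
    obtain ⟨h₁, h₂, h₃, h₄, h₆⟩ := valuation_congruentNumberCurve_a_le_one v n
    by_cases hv : natGenerator v = 2
    · rcases Nat.even_or_odd n with heven | hodd
      · exact isMinimalAt_congruentNumberCurve_two_of_even v hn heven hv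
      · exact isMinimalAt_of_lt_valuation_Δ_holds
          ((congruentNumberCurve n).isIntegralAt_of_valuation_le_one v h₁ h₂ h₃ h₄ h₆)
          (exp_neg_twelve_lt_valuation_congruentNumberCurve_Δ_two v hodd hv)
    · exact isMinimalAt_of_lt_valuation_Δ_holds
        ((congruentNumberCurve n).isIntegralAt_of_valuation_le_one v h₁ h₂ h₃ h₄ h₆)
        (exp_neg_twelve_lt_valuation_congruentNumberCurve_Δ v hn hv)

/-- **`E_n` has good reduction at every prime `p ∤ 2n`** (any `n`), in the prime-indexed form
`HasGoodReductionAtPrime` of the tree: `p ∤ Δ = 64 n⁶` of the `ℤ`-model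
(`not_dvd_congruentNumberCurveInt_Δ_of_not_dvd`), the sibling's `hasGoodReductionAt_map_of_not_dvd`
(Silverman, *AEC* VII.5 Prop. 5.1(a)), and the tree's bridge
`hasGoodReductionAtPrime_iff_hasGoodReductionAt_ringOfIntegers`. [folklore] -/
theorem hasGoodReductionAtPrime_congruentNumberCurve {n p : ℕ} [Fact p.Prime] (hp : ¬p ∣ 2 * n) :
    (congruentNumberCurve n).HasGoodReductionAtPrime p := by
  obtain ⟨v, rfl⟩ : ∃ v : HeightOneSpectrum (𝓞 ℚ), (primesEquiv v : ℕ) = p :=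
    ⟨primesEquiv.symm ⟨p, Fact.out⟩, by rw [Equiv.apply_symm_apply]⟩
  rw [← map_congruentNumberCurveInt_intCast]
  exact (hasGoodReductionAtPrime_iff_hasGoodReductionAt_ringOfIntegers v _).2
    (hasGoodReductionAt_map_of_not_dvd _ v
      (not_dvd_congruentNumberCurveInt_Δ_of_not_dvd Fact.out hp))

/-- The integral model over `ℤ` of the globally minimal `E_n` is `congruentNumberCurveInt n`
(`⟨0, 0, 0, -n², 0⟩`; uniqueness of lifts along the injection `ℤ → ℚ`). [folklore] -/
theorem integralModelInt_congruentNumberCurve (n : ℕ) [(congruentNumberCurve n).IsGloballyMinimal] :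
    integralModelInt (congruentNumberCurve n) = congruentNumberCurveInt n := by
  apply WeierstrassCurve.map_injective (f := Int.castRingHom ℚ) Int.cast_injective
  simp only [map_integralModelInt]
  exact (map_congruentNumberCurveInt_intCast n).symm

/-- For the globally minimal `E_n`, the tree's `reductionPointCount (E_n) p` (the `N_p` of
**bsd.S35**) is the number of points of `y² = x³ - n² x` over `ℤ/p`,
`Literature.Lang.numPointsMod (congruentNumberCurveInt n) p`. [folklore] -/
theorem reductionPointCount_congruentNumberCurve (n p : ℕ)
    [(congruentNumberCurve n).IsGloballyMinimal] :
    reductionPointCount (congruentNumberCurve n) p =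
      Literature.NumberTheory.Automorphic.numPointsMod (congruentNumberCurveInt n) p := by
  rw [reductionPointCount, integralModelInt_congruentNumberCurve, Literature.NumberTheory.Automorphic.numPointsMod]

/-- For the globally minimal `E_n`, the tree's trace of Frobenius of the global minimal model at
`p` (the `a_p` of **bsd.S35**) is `p + 1 - #Ẽ_n(𝔽_p)` computed on `y² = x³ - n² x`,
`Literature.Lang.frobeniusTrace (congruentNumberCurveInt n) p`. [folklore] -/
theorem frobeniusTrace_congruentNumberCurve (n p : ℕ) [(congruentNumberCurve n).IsGloballyMinimal] :
    frobeniusTrace (congruentNumberCurve n) p =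
      Literature.NumberTheory.Automorphic.frobeniusTrace (congruentNumberCurveInt n) p := by
  rw [frobeniusTrace, reductionPointCount_congruentNumberCurve, Literature.NumberTheory.Automorphic.frobeniusTrace]

/-- **The `p`-th coefficient of `L(E_n, s)` is `p + 1 - #Ẽ_n(𝔽_p)` for every prime `p ∤ 2n` and
every `n`** (the tree's `Literature.NumberTheory.Automorphic.lFunction_map_apply_prime_of_not_dvd` on the `ℤ`-model, `p ∤ Δ`;
for squarefree `n` this is the second branch of the sibling's
`lFunction_congruentNumberCurve_apply_prime`). Ireland–Rosen, Ch. 18 §2, §6: "The numbers `a_p`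
are determined by `N_p = p + 1 - a_p`". [folklore] -/
theorem LFunction_congruentNumberCurve_prime {n p : ℕ} (hp : p.Prime) (hpn : ¬p ∣ 2 * n) :
    (congruentNumberCurve n).LFunction p =
      p + 1 - (Literature.NumberTheory.Automorphic.numPointsMod (congruentNumberCurveInt n) p : ℤ) := by
  rw [← map_congruentNumberCurveInt_intCast, Literature.NumberTheory.Automorphic.lFunction_map_apply_prime_of_not_dvd _ hp
    (not_dvd_congruentNumberCurveInt_Δ_of_not_dvd hp hpn), Literature.NumberTheory.Automorphic.frobeniusTrace]

end GlobalMinimal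

/-! ### Tunnell's theorem in vanishing form from Waldspurger's proportionality alone

On p. 329 Tunnell fixes the constants of Waldspurger's proportionality from `a(1) = 1`,
`a(3) = 2` and the values `L(E, 1) = β/4`, `L(E³, 1) 3^{1/2} = β` of [3, Table 1]: "this shows
that `4/β = β₁² = β₃²`". For the VANISHING statement — `a(n) = 0 ↔ L(Eⁿ, 1) = 0` for `n` odd
and square-free, which under the conjecture of Birch and Swinnerton-Dyer is "`d` is a congruent
number if and only if `a(d) + b(d/2) = 0`" (§3, p. 330) — the values of [3] are not needed:
`1 = a(1)² = β₁² L(E, 1)` and `4 = a(3)² = β₃² L(E³, 1) 3^{1/2}` already force `β₁² ≠ 0` and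
`β₃² ≠ 0`, so on the classes `1, 3` modulo `8` the square `a(n)² = βᵢ² L(Eⁿ, 1) n^{1/2}` vanishes
iff `L(Eⁿ, 1)` does, while on the classes `5, 7` both `a(n)` and `L(Eⁿ, 1)` vanish
(`Tunnell1983.a_eq_zero_of_mod_eight` and Waldspurger). Likewise for `b` with `b(1) = 1`,
`b(5) = 2`. Hence the sibling facts `tunnell_lvalue_odd/even` (`BSDAnalyticRankProofs`: Tunnell's
theorem in vanishing form, an `↔`) follow from `Tunnell1983_a/b_sq_eq_const_mul_L_one` and the
continuation of `L(E_n, s)` for squarefree `n` (`hL : hasEntireLFunction_congruentNumberCurve`,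
itself now a theorem of the tree: `hasEntireLFunction_congruentNumberCurve_holds` of the sibling
`CongruentNumberCurveLSeriesProofs`, which records the direction `a(d) = 0 ⇒ L(E^d, 1) = 0` of
this remark as `entireLFunction_one_eq_zero_of_a/b_eq_zero` and its consequence
`tunnell_converse_odd/even_of_waldspurger` for bsd.S29; feeding `hL` with that theorem leaves
`tunnell_lvalue_odd/even` behind the single named fact `Tunnell1983_a/b_sq_eq_const_mul_L_one`). -/

section Waldspurger

/-- One residue class of Waldspurger's proportionality: if `a² = c · L · x` with `c ≠ 0` and
`x ≠ 0` (`c = βᵢ²`, `L = L(Eⁿ, 1)`, `x = n^{1/2}`), then `L = 0 ↔ a = 0`. [folklore] -/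
theorem eq_zero_iff_of_sq_eq_const_mul {a : ℚ} {c L x : ℂ} (hc : c ≠ 0) (hx : x ≠ 0)
    (e : (a : ℂ) ^ 2 = c * L * x) : L = 0 ↔ a = 0 := by
  constructor
  · intro h0
    rw [h0, mul_zero, zero_mul] at e
    exact_mod_cast (pow_eq_zero_iff two_ne_zero).1 e
  · intro ha
    rw [ha, Rat.cast_zero, zero_pow two_ne_zero] at e
    rcases mul_eq_zero.1 e.symm with h | h
    · exact (mul_eq_zero.1 h).resolve_left hc
    · exact absurd h hx

/-- **Tunnell's theorem in vanishing form, odd case (`tunnell_lvalue_odd`), from Waldspurger's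
proportionality for `g θ₂` and the continuation of `L(E_n, s)` for squarefree `n`** — without the
`L`-values of Birch–Swinnerton-Dyer (1965). For `n` squarefree and odd (Tunnell p. 329):
on the class `n ≡ 1 (8)`, `a(n)² = β₁² L(Eⁿ, 1) n^{1/2}` with `β₁² ≠ 0` because
`1 = a(1)² = β₁² L(E, 1)` (`Tunnell1983.a_one`); on the class `3`, `a(n)² = β₃² L(Eⁿ, 1) n^{1/2}`
with `β₃² ≠ 0` because `4 = a(3)² = β₃² L(E³, 1) 3^{1/2}` (`Tunnell1983.a_three`); on the classes
`5, 7`, `L(Eⁿ, 1) = 0` (Waldspurger, `A(n) = 0`) and `a(n) = 0`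
(`Tunnell1983.a_eq_zero_of_mod_eight`). Hence `L(Eⁿ, 1) = 0 ↔ a(n) = 0`, which is the count
identity of `tunnell_lvalue_odd` (`Tunnell1983.a_eq_zero_iff`). The continuation `hL` is the
junk-value guard of the fact at `n = 1, 3`.
[cite: Tunnell1983Congruent, Theorem (Waldspurger) p. 328, proof of Thm 3 p. 329, §3 p. 330] -/
theorem tunnell_lvalue_odd_of_waldspurger (hW : Tunnell1983_a_sq_eq_const_mul_L_one)
    (hL : hasEntireLFunction_congruentNumberCurve) : tunnell_lvalue_odd := by
  obtain ⟨c₁, c₃, hW⟩ := hW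
  intro n hn hodd hLn
  rw [← Tunnell1983.a_eq_zero_iff]
  have hn0 : (0 : ℝ) < n := by exact_mod_cast Nat.pos_of_ne_zero hn.ne_zero
  have hsn : (Real.sqrt n : ℂ) ≠ 0 := Complex.ofReal_ne_zero.2 (Real.sqrt_pos.2 hn0).ne'
  rcases mod_eight_of_odd hodd with h8 | h8 | h8
  · -- `n ≡ 1 (mod 8)`: `β₁² ≠ 0` since `a(1) = 1`
    have e1 := (hW squarefree_one (hL squarefree_one)).1 rfl
    rw [Tunnell1983.a_one] at e1
    have hc : c₁ ≠ 0 := by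
      rintro rfl
      norm_num at e1
    exact eq_zero_iff_of_sq_eq_const_mul hc hsn ((hW hn hLn).1 h8)
  · -- `n ≡ 3 (mod 8)`: `β₃² ≠ 0` since `a(3) = 2`
    have h3 : Squarefree 3 := Nat.prime_three.prime.squarefree
    have e3 := (hW h3 (hL h3)).2.1 rfl
    rw [Tunnell1983.a_three] at e3
    have hc : c₃ ≠ 0 := by
      rintro rfl
      norm_num at e3
    exact eq_zero_iff_of_sq_eq_const_mul hc hsn ((hW hn hLn).2.1 h8)
  · -- `n ≡ 5, 7 (mod 8)`: both sides vanish
    exact iff_of_true ((hW hn hLn).2.2 h8) (Tunnell1983.a_eq_zero_of_mod_eight h8)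

/-- **Tunnell's theorem in vanishing form, even case (`tunnell_lvalue_even`), from Waldspurger's
proportionality for `g θ₄` and the continuation of `L(E_n, s)` for squarefree `n`** — without the
`L`-values of Birch–Swinnerton-Dyer (1965). Write `n = 2d`, `d` odd and squarefree (Tunnell
p. 329, character `χ₂`): on the class `d ≡ 1 (8)`, `b(d)² = γ₁² L(E^{2d}, 1) d^{1/2}` with
`γ₁² ≠ 0` because `1 = b(1)² = γ₁² L(E², 1)` (`Tunnell1983.b_one`); on the class `5`,
`γ₅² ≠ 0` because `4 = b(5)² = γ₅² L(E¹⁰, 1) 5^{1/2}` (`Tunnell1983.b_five`); on the classes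
`3, 7`, `L(E^{2d}, 1) = 0` (Waldspurger) and `b(d) = 0` (`Tunnell1983.b_eq_zero_of_mod_eight`).
Hence `L(E^{2d}, 1) = 0 ↔ b(d) = 0`, the count identity of `tunnell_lvalue_even` at `n = 2d`
(`Tunnell1983.b_eq_zero_iff`). The continuation `hL` is the junk-value guard at `n = 2, 10`.
[cite: Tunnell1983Congruent, Theorem (Waldspurger) p. 328, proof of Thm 3 p. 329, §3 p. 330] -/
theorem tunnell_lvalue_even_of_waldspurger (hW : Tunnell1983_b_sq_eq_const_mul_L_one)
    (hL : hasEntireLFunction_congruentNumberCurve) : tunnell_lvalue_even := by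
  obtain ⟨c₁, c₅, hW⟩ := hW
  intro n hn heven hLn
  obtain ⟨d, rfl⟩ := heven.two_dvd
  rw [Nat.cast_mul, Nat.cast_ofNat, ← Tunnell1983.b_eq_zero_iff]
  have hd : Squarefree d := hn.of_mul_right
  have hd0 : (0 : ℝ) < d := by exact_mod_cast Nat.pos_of_ne_zero hd.ne_zero
  have hsd : (Real.sqrt d : ℂ) ≠ 0 := Complex.ofReal_ne_zero.2 (Real.sqrt_pos.2 hd0).ne'
  have hWd := hW hd hLn
  rcases mod_eight_of_odd (odd_of_squarefree_two_mul hn) with h8 | h8 | h8 | h8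
  · -- `d ≡ 1 (mod 8)`: `γ₁² ≠ 0` since `b(1) = 1` (`E^{2·1} = E²`)
    have h2 : Squarefree (2 * 1) := Nat.prime_two.prime.squarefree
    have e1 := (hW squarefree_one (hL h2)).1 rfl
    rw [Tunnell1983.b_one] at e1
    have hc : c₁ ≠ 0 := by
      rintro rfl
      norm_num at e1
    exact eq_zero_iff_of_sq_eq_const_mul hc hsd (hWd.1 h8)
  · -- `d ≡ 3 (mod 8)`: both sides vanish
    exact iff_of_true (hWd.2.2 (Or.inl h8)) (Tunnell1983.b_eq_zero_of_mod_eight (Or.inl h8))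
  · -- `d ≡ 5 (mod 8)`: `γ₅² ≠ 0` since `b(5) = 2` (`E^{2·5} = E¹⁰`)
    have h10 : Squarefree (2 * 5) :=
      (Nat.squarefree_mul (by norm_num : Nat.Coprime 2 5)).2
        ⟨Nat.prime_two.prime.squarefree, Nat.prime_five.prime.squarefree⟩
    have e5 := (hW Nat.prime_five.prime.squarefree (hL h10)).2.1 rfl
    rw [Tunnell1983.b_five] at e5
    have hc : c₅ ≠ 0 := by
      rintro rfl
      norm_num at e5
    exact eq_zero_iff_of_sq_eq_const_mul hc hsd (hWd.2.1 h8)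
  · -- `d ≡ 7 (mod 8)`: both sides vanish
    exact iff_of_true (hWd.2.2 (Or.inr h8)) (Tunnell1983.b_eq_zero_of_mod_eight (Or.inr h8))

end Waldspurger

end Literature.NumberTheory.EllipticCurves

end
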